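import Mathlib

/-!
# `WeightedInvariant.LocalWeightedDrop`: NC-resolution settings for the TOT₂ line — GRAPH SURFACES, part 22: THE MONOMIAL ENDGAME HAS NO INFINITE PLAY
# (a combinatorial game on multisets of exponent pairs)

Crux item stmt-ResolutionOfSingularities-8899 `LocalWeightedDrop` (route `ResolutionOfSingularities/WeightedInvariant`), ENGINE skeleton v34/v35, residual
`stub_wildWideApexFourStartsWon`, line `directrix-cut` piece PL₃, stub `stub_apexPlaneSurfaceThree` (S-E2-SURF, the loop `SurfLoop`); design memo
`L/res-L1-w43-stub-4/g6/SURFLOOP-DESIGN.md` §3.  [OURS · L1 W4.3 · chain w43 · seat res-L1-w43-stub-4 gen 6; PURE COMBINATORICS (no power series): the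
abstract shadow of the monomial endgame of the loop and the proof that the loop's strategy admits no infinite play; the count game is the programme's own;
nothing here is a statement of any manuscript; AI-produced, gate-checked, weaker than expert review.]

THE GAME.  A position is a finite multiset `M` of pairs `(p, q) ∈ ℕ² ∖ {(0,0)}` (the exponents of the boundary traces `unit · x₀^p x₁^q` on the surface).
The mover's strategy: if every `p ≥ 1`, the curve move along the first axis (`Γ₁`: `(p,q) ↦ (p−1,q)`, the letter `(1,0)` dies); else if every `q ≥ 1`,
the curve move along the second axis read with the exceptional letter first (`Γ₂`: `(p,q) ↦ (q−1,p)`, `(0,1)` dies); else the point move, whose outcome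
the opponent chooses among `A`: `(p,q) ↦ (p+q−1, q)` (`(1,0)` dies), `B`: `(p,q) ↦ (p+q−1, p)` (`(0,1)` dies), `G`: `(p,q) ↦ (p+q−1, 0)` (both die) —
the three readings of an exceptional point on, respectively off, the two base axes (memo §3; parts 20–21 identify the loop's successors with these maps).

* `Endgame.Step M M'` — `M'` is a position the strategy can lead to from `M` in one move;
* **`Endgame.no_infinite_play`** — there is no infinite sequence `M₀ → M₁ → ⋯` of steps.
PROOF.  The number of letters never increases, so it is eventually constant (no deaths).  Curve moves lower the total weight `Σ (p+q)` by the number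
of letters, so point moves recur for ever.  After a point move the class of letters with `q = 0` is non-empty and stays so (`Γ₂` never recurs; an
outcome `G` would leave only `q = 0` letters and then only `Γ₁` moves — impossible); between consecutive point moves only `Γ₁` is played, exactly
`w_min − 1` times (`w_min` the least weight).  Along consecutive point positions the quantity «`q` of a letter `(0,q)` plus `p` of a letter `(p,0)`»
can be chosen strictly decreasing (A-round: `≤ p`, B-round: `≤ q`), which is absurd.
-/

set_option linter.dupNamespace false -- mandated namespace of this single-conjunct summit

namespace Summit.ResolutionOfSingularities.ResolutionOfSingularities.Theorems

namespace TameFourTupleDrop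

namespace GraphSurf

namespace Endgame

/-! ## The moves -/

/-- Outcome `A` of the point move (new point on the second base axis): `(p,q) ↦ (p+q−1, q)`. [OURS] -/
def stepA (x : ℕ × ℕ) : ℕ × ℕ := (x.1 + x.2 - 1, x.2)

/-- Outcome `B` of the point move (new point on the first base axis, read with the exceptional letter first): `(p,q) ↦ (p+q−1, p)`. [OURS] -/
def stepB (x : ℕ × ℕ) : ℕ × ℕ := (x.1 + x.2 - 1, x.1)

/-- Outcome `G` of the point move (new point off both axes): `(p,q) ↦ (p+q−1, 0)`. [OURS] -/
def stepG (x : ℕ × ℕ) : ℕ × ℕ := (x.1 + x.2 - 1, 0)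

/-- The curve move along the first axis: `(p,q) ↦ (p−1, q)`. [OURS] -/
def stepC₁ (x : ℕ × ℕ) : ℕ × ℕ := (x.1 - 1, x.2)

/-- The curve move along the second axis, read with the exceptional letter first: `(p,q) ↦ (q−1, p)`. [OURS] -/
def stepC₂ (x : ℕ × ℕ) : ℕ × ℕ := (x.2 - 1, x.1)

/-- The position after outcome `A`: the letter `(1,0)` dies. [OURS] -/
def moveA (M : Multiset (ℕ × ℕ)) : Multiset (ℕ × ℕ) := (M.filter fun x => x ≠ (1, 0)).map stepA

/-- The position after outcome `B`: the letter `(0,1)` dies. [OURS] -/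
def moveB (M : Multiset (ℕ × ℕ)) : Multiset (ℕ × ℕ) := (M.filter fun x => x ≠ (0, 1)).map stepB

/-- The position after outcome `G`: the letters `(1,0)`, `(0,1)` die. [OURS] -/
def moveG (M : Multiset (ℕ × ℕ)) : Multiset (ℕ × ℕ) := (M.filter fun x => x ≠ (1, 0) ∧ x ≠ (0, 1)).map stepG

/-- The position after the first curve move: `(1,0)` dies. [OURS] -/
def moveC₁ (M : Multiset (ℕ × ℕ)) : Multiset (ℕ × ℕ) := (M.filter fun x => x ≠ (1, 0)).map stepC₁

/-- The position after the second curve move: `(0,1)` dies. [OURS] -/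
def moveC₂ (M : Multiset (ℕ × ℕ)) : Multiset (ℕ × ℕ) := (M.filter fun x => x ≠ (0, 1)).map stepC₂

/-- The first curve move is available: every `p ≥ 1`. [OURS] -/
def C₁Avail (M : Multiset (ℕ × ℕ)) : Prop := ∀ x ∈ M, 1 ≤ x.1

/-- The second curve move is available: every `q ≥ 1`. [OURS] -/
def C₂Avail (M : Multiset (ℕ × ℕ)) : Prop := ∀ x ∈ M, 1 ≤ x.2

/-- ONE STEP OF THE STRATEGY from a non-empty position without `(0,0)`: `Γ₁` if available, else `Γ₂` if available, else the point move with any of the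
three outcomes. [OURS] -/
def Step (M M' : Multiset (ℕ × ℕ)) : Prop :=
  M ≠ 0 ∧ (∀ x ∈ M, x ≠ (0, 0)) ∧
    ((C₁Avail M ∧ M' = moveC₁ M) ∨ (¬ C₁Avail M ∧ C₂Avail M ∧ M' = moveC₂ M) ∨
      (¬ C₁Avail M ∧ ¬ C₂Avail M ∧ (M' = moveA M ∨ M' = moveB M ∨ M' = moveG M)))

/-- A point move happens at `M`: neither curve move is available. [OURS] -/
def IsP (M : Multiset (ℕ × ℕ)) : Prop := ¬ C₁Avail M ∧ ¬ C₂Avail M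

/-! ## Cardinality: deaths only -/

/-- A step never increases the number of letters. -/
theorem card_le_of_step {M M' : Multiset (ℕ × ℕ)} (h : Step M M') : Multiset.card M' ≤ Multiset.card M := by
  obtain ⟨-, -, h⟩ := h
  rcases h with ⟨-, rfl⟩ | ⟨-, -, rfl⟩ | ⟨-, -, rfl | rfl | rfl⟩
  all_goals
    first
    | (rw [moveC₁, Multiset.card_map]; exact Multiset.card_le_card (Multiset.filter_le _ _))
    | (rw [moveC₂, Multiset.card_map]; exact Multiset.card_le_card (Multiset.filter_le _ _))
    | (rw [moveA, Multiset.card_map]; exact Multiset.card_le_card (Multiset.filter_le _ _))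
    | (rw [moveB, Multiset.card_map]; exact Multiset.card_le_card (Multiset.filter_le _ _))
    | (rw [moveG, Multiset.card_map]; exact Multiset.card_le_card (Multiset.filter_le _ _))

/-- A filter that keeps the cardinality keeps everything. -/
theorem filter_eq_self_of_card {M : Multiset (ℕ × ℕ)} {p : ℕ × ℕ → Prop} [DecidablePred p]
    (h : Multiset.card M ≤ Multiset.card (M.filter p)) : M.filter p = M :=
  Multiset.eq_of_le_of_card_le (Multiset.filter_le _ _) h

/-- A NO-DEATH STEP is a plain map: `Γ₁`. -/
theorem eq_map_C₁ {M M' : Multiset (ℕ × ℕ)} (hM' : M' = moveC₁ M) (hcard : Multiset.card M ≤ Multiset.card M') :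
    M' = M.map stepC₁ ∧ (1, 0) ∉ M := by
  rw [hM', moveC₁, Multiset.card_map] at hcard
  have h := filter_eq_self_of_card hcard
  refine ⟨by rw [hM', moveC₁, h], fun hx => ?_⟩
  have := Multiset.filter_eq_self.mp h _ hx
  exact this rfl

/-- A no-death step is a plain map: `Γ₂`. -/
theorem eq_map_C₂ {M M' : Multiset (ℕ × ℕ)} (hM' : M' = moveC₂ M) (hcard : Multiset.card M ≤ Multiset.card M') :
    M' = M.map stepC₂ ∧ (0, 1) ∉ M := by
  rw [hM', moveC₂, Multiset.card_map] at hcard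
  have h := filter_eq_self_of_card hcard
  refine ⟨by rw [hM', moveC₂, h], fun hx => ?_⟩
  have := Multiset.filter_eq_self.mp h _ hx
  exact this rfl

/-- A no-death step is a plain map: `A`. -/
theorem eq_map_A {M M' : Multiset (ℕ × ℕ)} (hM' : M' = moveA M) (hcard : Multiset.card M ≤ Multiset.card M') :
    M' = M.map stepA ∧ (1, 0) ∉ M := by
  rw [hM', moveA, Multiset.card_map] at hcard
  have h := filter_eq_self_of_card hcard
  refine ⟨by rw [hM', moveA, h], fun hx => ?_⟩
  have := Multiset.filter_eq_self.mp h _ hx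
  exact this rfl

/-- A no-death step is a plain map: `B`. -/
theorem eq_map_B {M M' : Multiset (ℕ × ℕ)} (hM' : M' = moveB M) (hcard : Multiset.card M ≤ Multiset.card M') :
    M' = M.map stepB ∧ (0, 1) ∉ M := by
  rw [hM', moveB, Multiset.card_map] at hcard
  have h := filter_eq_self_of_card hcard
  refine ⟨by rw [hM', moveB, h], fun hx => ?_⟩
  have := Multiset.filter_eq_self.mp h _ hx
  exact this rfl

/-- A no-death step is a plain map: `G`. -/
theorem eq_map_G {M M' : Multiset (ℕ × ℕ)} (hM' : M' = moveG M) (hcard : Multiset.card M ≤ Multiset.card M') :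
    M' = M.map stepG ∧ (1, 0) ∉ M ∧ (0, 1) ∉ M := by
  rw [hM', moveG, Multiset.card_map] at hcard
  have h := filter_eq_self_of_card hcard
  refine ⟨by rw [hM', moveG, h], fun hx => ?_, fun hx => ?_⟩
  · exact (Multiset.filter_eq_self.mp h _ hx).1 rfl
  · exact (Multiset.filter_eq_self.mp h _ hx).2 rfl

/-! ## The total weight and the recurrence of point moves -/

/-- The total weight `Σ (p + q)`. [OURS] -/
def weight (M : Multiset (ℕ × ℕ)) : ℕ := (M.map fun x => x.1 + x.2).sum

/-- A no-death curve move `Γ₁` lowers the weight by the number of letters. -/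
theorem weight_map_C₁ {M : Multiset (ℕ × ℕ)} (h : C₁Avail M) : weight (M.map stepC₁) + Multiset.card M = weight M := by
  rw [weight, weight, Multiset.map_map]
  rw [show Multiset.card M = (M.map fun _ => (1 : ℕ)).sum by simp, ← Multiset.sum_map_add]
  congr 1
  refine Multiset.map_congr rfl fun x hx => ?_
  have := h x hx
  simp only [Function.comp, stepC₁]
  omega

/-- A no-death curve move `Γ₂` lowers the weight by the number of letters. -/
theorem weight_map_C₂ {M : Multiset (ℕ × ℕ)} (h : C₂Avail M) : weight (M.map stepC₂) + Multiset.card M = weight M := by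
  rw [weight, weight, Multiset.map_map]
  rw [show Multiset.card M = (M.map fun _ => (1 : ℕ)).sum by simp, ← Multiset.sum_map_add]
  congr 1
  refine Multiset.map_congr rfl fun x hx => ?_
  have := h x hx
  simp only [Function.comp, stepC₂]
  omega

/-! ## No infinite play -/

/-- A point move is forced at `M`: some letter has `p = 0` and some letter has `q = 0`. -/
theorem exists_of_isP {M : Multiset (ℕ × ℕ)} (h : IsP M) : (∃ x ∈ M, x.1 = 0) ∧ ∃ y ∈ M, y.2 = 0 := by
  obtain ⟨h1, h2⟩ := h
  unfold C₁Avail at h1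
  unfold C₂Avail at h2
  push Not at h1 h2
  obtain ⟨x, hx, hx1⟩ := h1
  obtain ⟨y, hy, hy2⟩ := h2
  exact ⟨⟨x, hx, by omega⟩, ⟨y, hy, by omega⟩⟩

section chain

variable {f : ℕ → Multiset (ℕ × ℕ)} (hf : ∀ n, Step (f n) (f (n + 1))) (hcard : ∀ n, Multiset.card (f n) = Multiset.card (f 0))
include hf hcard

/-- In a chain without deaths a non-point step is a plain curve map lowering the weight by the number of letters. -/
theorem curve_step_of_not_isP {n : ℕ} (hn : ¬ IsP (f n)) :
    (C₁Avail (f n) ∧ f (n + 1) = (f n).map stepC₁ ∨ C₂Avail (f n) ∧ f (n + 1) = (f n).map stepC₂) ∧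
      weight (f (n + 1)) + Multiset.card (f 0) = weight (f n) := by
  obtain ⟨-, -, h⟩ := hf n
  have hc : Multiset.card (f n) ≤ Multiset.card (f (n + 1)) := by rw [hcard n, hcard (n + 1)]
  rcases h with ⟨h1, he⟩ | ⟨-, h2, he⟩ | ⟨h1, h2, -⟩
  · obtain ⟨he', -⟩ := eq_map_C₁ he hc
    exact ⟨Or.inl ⟨h1, he'⟩, by rw [he', ← hcard n]; exact weight_map_C₁ h1⟩
  · obtain ⟨he', -⟩ := eq_map_C₂ he hc
    exact ⟨Or.inr ⟨h2, he'⟩, by rw [he', ← hcard n]; exact weight_map_C₂ h2⟩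
  · exact absurd ⟨h1, h2⟩ hn

/-- POINT MOVES RECUR: after every index some point move happens (else the weight would decrease for ever). -/
theorem exists_isP_ge (n : ℕ) : ∃ n', n ≤ n' ∧ IsP (f n') := by
  by_contra hno
  push Not at hno
  have hK : 1 ≤ Multiset.card (f 0) := by
    rw [← hcard n, Nat.one_le_iff_ne_zero, ne_eq, Multiset.card_eq_zero]
    exact (hf n).1
  have hdec : ∀ j, weight (f (n + j)) + j ≤ weight (f n) := by
    intro j
    induction j with
    | zero => simp
    | succ j ih =>
      have h := (curve_step_of_not_isP hf hcard (hno (n + j) (Nat.le_add_right n j))).2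
      rw [show n + (j + 1) = n + j + 1 by ring]
      omega
  have := hdec (weight (f n) + 1)
  omega

/-- THE CURVE RUN AFTER A POINT MOVE: if `f (t+1)` has a letter with `q = 0`, then as long as no point move occurs only `Γ₁` is played: the position at
`t + 1 + i` is `f (t+1)` with every `p` lowered by `i`, and every `p` was at least `i`. -/
theorem run {t : ℕ} (hq : ∃ x ∈ f (t + 1), x.2 = 0) :
    ∀ i, (∀ i', i' < i → ¬ IsP (f (t + 1 + i'))) →
      f (t + 1 + i) = (f (t + 1)).map (fun x => (x.1 - i, x.2)) ∧ ∀ x ∈ f (t + 1), i ≤ x.1 := by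
  intro i
  induction i with
  | zero =>
    intro _
    refine ⟨?_, fun x _ => Nat.zero_le _⟩
    rw [add_zero]
    conv_lhs => rw [← Multiset.map_id (f (t + 1))]
    exact Multiset.map_congr rfl fun x _ => by simp
  | succ i ih =>
    intro hno
    obtain ⟨heq, hle⟩ := ih fun i' hi' => hno i' (Nat.lt_succ_of_lt hi')
    have hs := curve_step_of_not_isP hf hcard (hno i (Nat.lt_succ_self i))
    obtain ⟨x₀, hx₀, hx₀2⟩ := hq
    -- the step at `t + 1 + i` is `Γ₁`: a letter with `q = 0` is present
    have hnot2 : ¬ C₂Avail (f (t + 1 + i)) := by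
      intro h2
      have hmem : (x₀.1 - i, x₀.2) ∈ f (t + 1 + i) := by
        rw [heq]
        exact Multiset.mem_map.mpr ⟨x₀, hx₀, rfl⟩
      have := h2 _ hmem
      simp [hx₀2] at this
    rcases hs.1 with ⟨h1, he⟩ | ⟨h2, -⟩
    · refine ⟨?_, fun x hx => ?_⟩
      · rw [show t + 1 + (i + 1) = t + 1 + i + 1 by ring, he, heq, Multiset.map_map]
        refine Multiset.map_congr rfl fun x _ => ?_
        simp only [Function.comp, stepC₁]
        exact Prod.ext (by show x.1 - i - 1 = x.1 - (i + 1); omega) rfl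
      · have hmem : (x.1 - i, x.2) ∈ f (t + 1 + i) := by
          rw [heq]
          exact Multiset.mem_map.mpr ⟨x, hx, rfl⟩
        have := h1 _ hmem
        simp only at this
        omega
    · exact absurd h2 hnot2

/-- **THE ROUND LEMMA WITH WITNESSES.**  From a point position `f t` with letters `(0, q₁)` and `(p₂, 0)`, `q₁ + p₂ ≤ v`, there is no escape: the
next point position carries such letters with a strictly smaller sum. -/
theorem false_of_isP : ∀ (v : ℕ) (t : ℕ), IsP (f t) →
    (∃ x ∈ f t, x.1 = 0 ∧ ∃ y ∈ f t, y.2 = 0 ∧ x.2 + y.1 ≤ v) → False := by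
  intro v
  induction v with
  | zero =>
    rintro t - ⟨x, hx, hx1, y, -, -, hv⟩
    have hx0 : x ≠ (0, 0) := (hf t).2.1 x hx
    exact hx0 (Prod.ext (by show x.1 = 0; omega) (by show x.2 = 0; omega))
  | succ v ih =>
    rintro t hP ⟨x, hx, hx1, y, hy, hy2, hv⟩
    have hx0 : x ≠ (0, 0) := (hf t).2.1 x hx
    have hy0 : y ≠ (0, 0) := (hf t).2.1 y hy
    have hq₁ : 1 ≤ x.2 := by
      by_contra h
      exact hx0 (Prod.ext (by show x.1 = 0; omega) (by show x.2 = 0; omega))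
    have hp₂ : 1 ≤ y.1 := by
      by_contra h
      exact hy0 (Prod.ext (by show y.1 = 0; omega) (by show y.2 = 0; omega))
    have hc : Multiset.card (f t) ≤ Multiset.card (f (t + 1)) := by rw [hcard t, hcard (t + 1)]
    -- the next point index `t + 1 + j`
    obtain ⟨n', hn', hPn'⟩ := exists_isP_ge hf hcard (t + 1)
    have hex : ∃ j, IsP (f (t + 1 + j)) := ⟨n' - (t + 1), by rwa [Nat.add_sub_cancel' hn']⟩
    classical
    set j := Nat.find hex with hj
    have hPj : IsP (f (t + 1 + j)) := Nat.find_spec hex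
    have hmin : ∀ i', i' < j → ¬ IsP (f (t + 1 + i')) := fun i' hi' => Nat.find_min hex hi'
    obtain ⟨⟨x', hx', hx'1⟩, ⟨y', hy', hy'2⟩⟩ := exists_of_isP hPj
    -- the outcome of the point move at `t`
    obtain ⟨-, -, h⟩ := hf t
    rcases h with ⟨h1, -⟩ | ⟨-, h2, -⟩ | ⟨-, -, hA | hB | hG⟩
    · exact absurd h1 hP.1
    · exact absurd h2 hP.2
    · -- outcome A
      obtain ⟨he, h10⟩ := eq_map_A hA hc
      have hq : ∃ z ∈ f (t + 1), z.2 = 0 := ⟨stepA y, by rw [he]; exact Multiset.mem_map_of_mem _ hy, by simp [stepA, hy2]⟩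
      obtain ⟨heq, hle⟩ := run hf hcard hq j hmin
      -- the zero letter at the next point position comes from a letter of minimal weight
      rw [heq, he, Multiset.map_map] at hx' hy'
      obtain ⟨z, hz, hzx'⟩ := Multiset.mem_map.mp hx'
      have hjy : j ≤ (stepA y).1 := hle _ (by rw [he]; exact Multiset.mem_map_of_mem _ hy)
      have hjz : j ≤ (stepA z).1 := hle _ (by rw [he]; exact Multiset.mem_map_of_mem _ hz)
      simp only [Function.comp, stepA] at hzx' hjy hjz
      refine ih (t + 1 + j) hPj ⟨x', ?_, hx'1, ((stepA y).1 - j, (stepA y).2), ?_, by simp [stepA, hy2], ?_⟩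
      · rw [heq, he, Multiset.map_map]
        exact Multiset.mem_map.mpr ⟨z, hz, hzx'⟩
      · rw [heq, he, Multiset.map_map]
        exact Multiset.mem_map.mpr ⟨y, hy, rfl⟩
      · rw [← hzx']
        simp only [stepA, hy2, add_zero]
        have h1 : z.1 + z.2 - 1 - j = 0 := by rw [← hzx'] at hx'1; exact hx'1
        omega
    · -- outcome B
      obtain ⟨he, h01⟩ := eq_map_B hB hc
      have hq : ∃ z ∈ f (t + 1), z.2 = 0 := ⟨stepB x, by rw [he]; exact Multiset.mem_map_of_mem _ hx, by simp [stepB, hx1]⟩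
      obtain ⟨heq, hle⟩ := run hf hcard hq j hmin
      rw [heq, he, Multiset.map_map] at hx' hy'
      obtain ⟨z, hz, hzx'⟩ := Multiset.mem_map.mp hx'
      have hjx : j ≤ (stepB x).1 := hle _ (by rw [he]; exact Multiset.mem_map_of_mem _ hx)
      have hjz : j ≤ (stepB z).1 := hle _ (by rw [he]; exact Multiset.mem_map_of_mem _ hz)
      simp only [Function.comp, stepB] at hzx' hjx hjz
      refine ih (t + 1 + j) hPj ⟨x', ?_, hx'1, ((stepB x).1 - j, (stepB x).2), ?_, by simp [stepB, hx1], ?_⟩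
      · rw [heq, he, Multiset.map_map]
        exact Multiset.mem_map.mpr ⟨z, hz, hzx'⟩
      · rw [heq, he, Multiset.map_map]
        exact Multiset.mem_map.mpr ⟨x, hx, rfl⟩
      · rw [← hzx']
        simp only [stepB, hx1, zero_add]
        have h1 : z.1 + z.2 - 1 - j = 0 := by rw [← hzx'] at hx'1; exact hx'1
        omega
    · -- outcome G: every letter becomes a pure first-axis power, and the next point position would contain `(0,0)`
      obtain ⟨he, -, -⟩ := eq_map_G hG hc
      have hq : ∃ z ∈ f (t + 1), z.2 = 0 := ⟨stepG y, by rw [he]; exact Multiset.mem_map_of_mem _ hy, by simp [stepG]⟩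
      obtain ⟨heq, -⟩ := run hf hcard hq j hmin
      rw [heq, he, Multiset.map_map] at hx'
      obtain ⟨z, -, hzx'⟩ := Multiset.mem_map.mp hx'
      have hx'0 : x' ≠ (0, 0) := (hf (t + 1 + j)).2.1 x' (by
        rw [heq, he, Multiset.map_map]; exact hx')
      apply hx'0
      rw [← hzx'] at hx'1 ⊢
      simp only [Function.comp, stepG] at hx'1 ⊢
      ext <;> simp [hx'1]

end chain

/-- **THE MONOMIAL ENDGAME ADMITS NO INFINITE PLAY** (OURS · L1 W4.3; memo §3). -/
theorem no_infinite_play (f : ℕ → Multiset (ℕ × ℕ)) : ¬ ∀ n, Step (f n) (f (n + 1)) := by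
  intro hf
  -- the number of letters is eventually constant
  have hanti : ∀ n j, Multiset.card (f (n + j)) ≤ Multiset.card (f n) := by
    intro n j
    induction j with
    | zero => simp
    | succ j ih => exact (card_le_of_step (hf (n + j))).trans ih
  obtain ⟨N, hN⟩ : ∃ N, ∀ n, Multiset.card (f N) ≤ Multiset.card (f n) := by
    classical
    have hne : (Set.range fun n => Multiset.card (f n)).Nonempty := ⟨_, 0, rfl⟩
    obtain ⟨N, hNv⟩ := Nat.sInf_mem hne
    have hNv' : Multiset.card (f N) = sInf (Set.range fun n => Multiset.card (f n)) := hNv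
    exact ⟨N, fun n => by rw [hNv']; exact Nat.sInf_le ⟨n, rfl⟩⟩
  -- pass to the tail `n ↦ f (N + n)`: no deaths there
  have hf' : ∀ n, Step (f (N + n)) (f (N + (n + 1))) := fun n => by
    rw [show N + (n + 1) = N + n + 1 by ring]; exact hf (N + n)
  have hcard' : ∀ n, Multiset.card (f (N + n)) = Multiset.card (f (N + 0)) := fun n => by
    rw [add_zero]; exact le_antisymm (hanti N n) (hN (N + n))
  obtain ⟨t, -, hP⟩ := exists_isP_ge (f := fun n => f (N + n)) hf' hcard' 0
  obtain ⟨⟨x, hx, hx1⟩, ⟨y, hy, hy2⟩⟩ := exists_of_isP hP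
  exact false_of_isP (f := fun n => f (N + n)) hf' hcard' (x.2 + y.1) t hP ⟨x, hx, hx1, y, hy, hy2, le_rfl⟩

end Endgame

end GraphSurf

end TameFourTupleDrop

end Summit.ResolutionOfSingularities.ResolutionOfSingularities.Theorems
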